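import Literature.AlgebraicGeometry.Surfaces.PolarisedK3TwinKuranishiFamily
import Literature.AlgebraicGeometry.Surfaces.K3PeriodSurjectivityProofs
import Literature.AlgebraicGeometry.Surfaces.K3TwistorLines
import Literature.AlgebraicGeometry.Surfaces.K3CMPeriodLattice
import Literature.AlgebraicGeometry.Surfaces.ShiodaInoseSingularK3

/-!
# Route NikulinTwinTransport · crux `K3PeriodSurjective` (stmt-HodgeConjecture-15154) —
# stub `stub_cmPeriod_realised` of line `IdeatorOneSketch` (card `ratner-orbit-closure-cm-seed`)

T2a of the line: every CM period vector `y ∈ D` (twenty independent lattice vectors orthogonal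
to `y`, i.e. the positive plane `P_y = ⟨Re y, Im y⟩ ⊂ Λ_ℝ` is rational) is REALISED by a marked
algebraic K3 surface (`IsK3Surface S`, `IsMarkedK3 S φ p y`). Proved here CONDITIONALLY
(`stub_cmPeriod_realised_of`) on three named facts of the tree, the first two vendored for this
stub in `Literature/AlgebraicGeometry/Surfaces/ShiodaInoseSingularK3`:

* `ShiodaInose1977_exists_singularK3_of_binaryForm` — SHIODA–INOSE 1977 (Huybrechts, *Lectures
  on K3 Surfaces*, Ch. 14 Cor. 3.21 with (3.2) and Rem. 3.22): every positive definite even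
  ORIENTED lattice of rank two, i.e. every integral matrix `((2a, b), (b, 2c))` with `a, c > 0`,
  `b² − 4ac < 0` up to `SL(2, ℤ)`, is the oriented transcendental lattice `T(X)` of a complex
  projective K3 surface `X` with `ρ(X) = 20` (the double cover of the Kummer surface of
  `E_{τ₁} × E_{τ₂}`), read through an arbitrary marking `η` of `X`;
* `Nikulin1980_k3Lattice_primitiveEmbedding_rankTwo_unique` — NIKULIN (Huybrechts Ch. 14
  Cor. 1.9 / Thm. 1.12 = Nikulin 1980 Thm. 1.14.4): a primitive embedding of a positive definite
  even lattice of rank `2 < 3 = min(3, 19)` into the even unimodular lattice `Λ_{K3}` of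
  signature `(3, 19)` is unique up to `O(Λ_{K3})`;
* the tree's `Huybrechts_K3_marking_exists` (Huybrechts Ch. 1 Prop. 3.5: markings exist).

## Proof (Huybrechts Ch. 14 §3.4, proof of Cor. 3.21, run backwards)

1. `exists_orientedBasis_of_isCMPeriod` (lattice bookkeeping, PROVED in
   `Literature/AlgebraicGeometry/Surfaces/K3CMPeriodLattice`): `Λ ∩ P_y` has a primitive `ℤ`-basis `(t₁, t₂)` with
   even positive definite Gram matrix `((2a, b), (b, 2c))`, positively oriented with respect to
   `(Re y, Im y)`: `t₁ = s₁ Re y + u₁ Im y`, `t₂ = s₂ Re y + u₂ Im y`, `s₁ u₂ − u₁ s₂ > 0`.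
2. Shioda–Inose gives `S` with `T(S) ≅ Λ ∩ P_y` as oriented lattices; a marking `(η, p, x)` of `S`
   (`Huybrechts_K3_marking_exists`) reads this as a positively oriented primitive pair
   `(t₁', t₂')` in `Λ` with the same Gram matrix and `x = c₁ t₁' + c₂ t₂'`, `Im(c̄₁ c₂) > 0`.
3. Nikulin gives `g ∈ O(Λ)` with `g tᵢ' = tᵢ`; the tree's `O(Λ)`-transport
   (`Huybrechts_K3_periodSurjective_projective.conclusion_of_latticeIsometry`,
   `isUnit_of_k3Isometry`) realises `g x = c₁ t₁ + c₂ t₂ ∈ (P_y)_ℂ`.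
4. `exists_eq_smul_of_oriented` (PROVED): an isotropic vector `d₁ Re y + d₂ Im y`
   (`d₁² + d₂² = 0`) with the orientation `Im(d̄₁ d₂) > 0` has `d₂ = i d₁`, `d₁ ≠ 0`, i.e. equals
   `d₁ y` ("`D ∩ ℙ(T_ℂ)` consists of precisely two points", `[y]` and `[ȳ]`); rescale by `d₁⁻¹`
   (`….conclusion_smul`).

References: T. Shioda, H. Inose, On singular K3 surfaces, in: Complex Analysis and Algebraic
Geometry (Iwanami Shoten / CUP 1977) 119–136, Thm. 4 [ShiodaInose1977]; V. V. Nikulin, Integral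
symmetric bilinear forms and some of their applications, Math. USSR Izv. 14 (1980) 103–167,
Thm. 1.14.4 [Nikulin1980]; D. Huybrechts, Lectures on K3 Surfaces (CUP 2016), Ch. 14 §0.2,
Cor. 1.9, Thm. 1.12, Cor. 3.10, Cor. 3.21, Rem. 3.22; Ch. 3 §3.1; Ch. 6 Prop. 1.5 [Huybrechts2016K3].
-/

noncomputable section

-- `Summit.HodgeConjecture.HodgeConjecture.…` is the mandated namespace (single-problem summit: Problem =
-- Summit), which `linter.dupNamespace` flags on every declaration; off tree-wide in the lakefile (weak
-- option), restated so that stand-alone elaboration is warning-free too.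
set_option linter.dupNamespace false

open scoped Matrix
open Literature.AlgebraicGeometry Literature.AlgebraicGeometry.Surfaces
  Literature.AlgebraicGeometry.HodgeTheory

namespace Summit.HodgeConjecture.HodgeConjecture.Theorems.NikulinTwinTransport

/-! ### Step 4: the two isotropic lines of a positive plane are told apart by the orientation -/

/-- **An isotropic vector of the complexified positive plane with the right orientation is a
non-zero multiple of the period vector** (Huybrechts Ch. 6 Prop. 1.5 and proof of Ch. 14
Cor. 3.21: "the period domain `D ⊂ ℙ(T_ℂ)` for each given lattice `T` consists of precisely two
points", `[y]` and `[ȳ]`): if `t₁ = s₁ Re y + u₁ Im y`, `t₂ = s₂ Re y + u₂ Im y` with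
`s₁ u₂ − u₁ s₂ > 0`, `Im(c̄₁ c₂) > 0` and `x' = c₁ t₁ + c₂ t₂` is isotropic, then `x' = d y` with
`d ≠ 0` (`x' = d₁ Re y + d₂ Im y`, `d₁² + d₂² = 0`, `Im(d̄₁ d₂) = (s₁ u₂ − u₁ s₂) Im(c̄₁ c₂) > 0`
rules out `d₂ = −i d₁`). -/
theorem exists_eq_smul_of_oriented {y : K3Index → ℂ} (hy : y ∈ k3PeriodDomain)
    {t₁ t₂ : K3Index → ℤ} {s₁ u₁ s₂ u₂ : ℝ}
    (ht₁ : (fun i => (t₁ i : ℝ)) = s₁ • (fun i => (y i).re) + u₁ • (fun i => (y i).im))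
    (ht₂ : (fun i => (t₂ i : ℝ)) = s₂ • (fun i => (y i).re) + u₂ • (fun i => (y i).im))
    (hdet : 0 < s₁ * u₂ - u₁ * s₂) {c₁ c₂ : ℂ} (hc : 0 < (star c₁ * c₂).im)
    (h0 : k3Form (c₁ • (fun i => (t₁ i : ℂ)) + c₂ • (fun i => (t₂ i : ℂ)))
      (c₁ • (fun i => (t₁ i : ℂ)) + c₂ • (fun i => (t₂ i : ℂ))) = 0) :
    ∃ d : ℂ, d ≠ 0 ∧ c₁ • (fun i => (t₁ i : ℂ)) + c₂ • (fun i => (t₂ i : ℂ)) = d • y := by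
  set E₁ : K3Index → ℂ := fun i => ((y i).re : ℂ) with hE₁
  set E₂ : K3Index → ℂ := fun i => ((y i).im : ℂ) with hE₂
  have hyE : y = E₁ + Complex.I • E₂ := by
    funext i
    apply Complex.ext <;> simp [E₁, E₂]
  obtain ⟨hC, hAB, hA⟩ := k3Period_re_im hy.1 hy.2
  set A : ℝ := ∑ i, ∑ j, (y i).re * k3Gram i j * (y j).re with hAdef
  have h11 : k3Form E₁ E₁ = (A : ℂ) := k3Form_ofReal _ _
  have h22 : k3Form E₂ E₂ = (A : ℂ) := by rw [hAB]; exact k3Form_ofReal _ _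
  have h12 : k3Form E₁ E₂ = 0 := by
    rw [hE₁, hE₂, k3Form_ofReal, hC, Complex.ofReal_zero]
  have h21 : k3Form E₂ E₁ = 0 := by rw [k3Form_comm, h12]
  -- complexify the real coordinate expressions of `t₁`, `t₂`
  have hT₁ : (fun i => (t₁ i : ℂ)) = (s₁ : ℂ) • E₁ + (u₁ : ℂ) • E₂ := by
    funext i
    have h := congrFun ht₁ i
    simp only [Pi.add_apply, Pi.smul_apply, smul_eq_mul] at h ⊢
    have h' := congrArg (fun r : ℝ => (r : ℂ)) h
    push_cast at h'
    exact h'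
  have hT₂ : (fun i => (t₂ i : ℂ)) = (s₂ : ℂ) • E₁ + (u₂ : ℂ) • E₂ := by
    funext i
    have h := congrFun ht₂ i
    simp only [Pi.add_apply, Pi.smul_apply, smul_eq_mul] at h ⊢
    have h' := congrArg (fun r : ℝ => (r : ℂ)) h
    push_cast at h'
    exact h'
  set d₁ : ℂ := c₁ * s₁ + c₂ * s₂ with hd₁
  set d₂ : ℂ := c₁ * u₁ + c₂ * u₂ with hd₂
  have hx' : c₁ • (fun i => (t₁ i : ℂ)) + c₂ • (fun i => (t₂ i : ℂ)) = d₁ • E₁ + d₂ • E₂ := by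
    rw [hT₁, hT₂]
    funext i
    simp only [Pi.add_apply, Pi.smul_apply, smul_eq_mul, hd₁, hd₂]
    ring
  -- `(x'.x') = (d₁² + d₂²) A = 0`
  have hsq : d₁ ^ 2 + d₂ ^ 2 = 0 := by
    rw [hx', k3Form_add_left, k3Form_add_right, k3Form_add_right, k3Form_smul_left,
      k3Form_smul_left, k3Form_smul_left, k3Form_smul_left, k3Form_smul_right,
      k3Form_smul_right, k3Form_smul_right, k3Form_smul_right, h11, h22, h12, h21] at h0
    have hA0 : (A : ℂ) ≠ 0 := Complex.ofReal_ne_zero.2 hA.ne'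
    have : (d₁ ^ 2 + d₂ ^ 2) * (A : ℂ) = 0 := by linear_combination h0
    exact (mul_eq_zero.1 this).resolve_right hA0
  -- the orientation: `Im(d̄₁ d₂) = det · Im(c̄₁ c₂) > 0`
  have hor : (star d₁ * d₂).im = (s₁ * u₂ - u₁ * s₂) * (star c₁ * c₂).im := by
    simp only [hd₁, hd₂, Complex.star_def, map_add, map_mul, Complex.conj_ofReal, Complex.mul_im,
      Complex.add_im, Complex.add_re, Complex.mul_re, Complex.ofReal_re, Complex.ofReal_im,
      Complex.conj_re, Complex.conj_im]
    ring
  have hor_pos : 0 < (star d₁ * d₂).im := by rw [hor]; exact mul_pos hdet hc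
  -- hence `d₂ = i d₁` with `d₁ ≠ 0`
  have hfac : (d₂ - Complex.I * d₁) * (d₂ + Complex.I * d₁) = 0 := by
    have : (d₂ - Complex.I * d₁) * (d₂ + Complex.I * d₁) = d₂ ^ 2 - Complex.I ^ 2 * d₁ ^ 2 := by
      ring
    rw [this, Complex.I_sq]
    linear_combination hsq
  have hd₂ : d₂ = Complex.I * d₁ := by
    rcases mul_eq_zero.1 hfac with h | h
    · exact sub_eq_zero.1 h
    · exfalso
      have h' : d₂ = -(Complex.I * d₁) := eq_neg_of_add_eq_zero_left h
      have : (star d₁ * d₂).im = -(d₁.re * d₁.re + d₁.im * d₁.im) := by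
        rw [h']
        simp only [Complex.star_def, mul_neg, Complex.neg_im, Complex.mul_im, Complex.mul_re,
          Complex.conj_re, Complex.conj_im, Complex.I_re, Complex.I_im]
        ring
      rw [this] at hor_pos
      nlinarith [mul_self_nonneg d₁.re, mul_self_nonneg d₁.im]
  have hd₁0 : d₁ ≠ 0 := by
    intro h
    rw [h, star_zero, zero_mul, Complex.zero_im] at hor_pos
    exact lt_irrefl _ hor_pos
  refine ⟨d₁, hd₁0, ?_⟩
  rw [hx', hd₂, hyE, smul_add, smul_smul, mul_comm]

/-! ### T2a from the named facts -/

/-- **T2a · CM period vectors are realised, conditionally on Shioda–Inose, Nikulin and the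
existence of markings** (Huybrechts Ch. 14 Cor. 3.21 / Rem. 3.22, Cor. 1.9 / Thm. 1.12, Ch. 1
Prop. 3.5): for `y ∈ D` with twenty independent lattice vectors orthogonal to it, take the
positively oriented primitive basis `(t₁, t₂)` of `Λ ∩ ⟨Re y, Im y⟩` (Step 1), the Shioda–Inose
surface `S` of its Gram matrix with any marking `(η, p, x)` and the resulting positively oriented
primitive basis `(t₁', t₂')` of `η(T(S)) ∋ x = c₁ t₁' + c₂ t₂'`, Nikulin's `g ∈ O(Λ)` with
`g tᵢ' = tᵢ`; then `(S, g ∘ η)` realises `g x = c₁ t₁ + c₂ t₂ = d y` (`d ≠ 0`, Step 4), and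
`(S, d⁻¹ g ∘ η)`-rescaling realises `y`. -/
theorem stub_cmPeriod_realised_of (hSI : ShiodaInose1977_exists_singularK3_of_binaryForm)
    (hNik : Nikulin1980_k3Lattice_primitiveEmbedding_rankTwo_unique)
    (hmark : Huybrechts_K3_marking_exists) :
    ∀ y : K3Index → ℂ, y ∈ k3PeriodDomain → (∃ N : Fin 20 → (K3Index → ℤ),
      LinearIndependent ℤ N ∧ ∀ k : Fin 20, k3Form (fun i => (N k i : ℂ)) y = 0) →
      ∃ (S : Motives.SchemeOver ℂ) (_ : IsK3Surface S)
        (φ : complexBetti S (2 * 1) ≃ₗ[ℂ] (K3Index → ℂ)) (p : complexBetti S (2 * 2)),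
        IsMarkedK3 S φ p y := by
  rintro y hy ⟨N, hN, hNy⟩
  obtain ⟨t₁, t₂, a, b, c, s₁, u₁, s₂, u₂, ha, hc, hdisc, h11, h12, h22, hprim, ht₁, ht₂, hdet⟩ :=
    exists_orientedBasis_of_isCMPeriod hy hN hNy
  obtain ⟨S, hS, H⟩ := hSI a b c ha hc hdisc
  obtain ⟨η, p, x, -, hM, hxx, -, -⟩ := hmark S hS
  obtain ⟨t₁', t₂', c₁, c₂, h11', h12', h22', hprim', hx, hor⟩ := H η p x hM
  obtain ⟨g, hg, hg₁, hg₂⟩ :=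
    hNik a b c ha hc hdisc t₁ t₂ t₁' t₂' h11 h12 h22 hprim h11' h12' h22' hprim'
  have hu : IsUnit g := isUnit_of_k3Isometry hg
  have hreal := Huybrechts_K3_periodSurjective_projective.conclusion_of_latticeIsometry hg hu
    ⟨S, hS, η, p, hM⟩
  have hgx : g.map (Int.cast : ℤ → ℂ) *ᵥ x =
      c₁ • (fun i => (t₁ i : ℂ)) + c₂ • (fun i => (t₂ i : ℂ)) := by
    rw [hx, Matrix.mulVec_add, Matrix.mulVec_smul, Matrix.mulVec_smul, intCast_map_mulVec,
      intCast_map_mulVec, hg₁, hg₂]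
  have h0 : k3Form (c₁ • (fun i => (t₁ i : ℂ)) + c₂ • (fun i => (t₂ i : ℂ)))
      (c₁ • (fun i => (t₁ i : ℂ)) + c₂ • (fun i => (t₂ i : ℂ))) = 0 := by
    rw [← hgx, k3Form_mulVec_mulVec_of_isometry hg, hxx]
  obtain ⟨d, hd, hdy⟩ := exists_eq_smul_of_oriented hy ht₁ ht₂ hdet hor h0
  rw [hgx, hdy] at hreal
  have h := Huybrechts_K3_periodSurjective_projective.conclusion_smul (inv_ne_zero hd) hreal
  rw [smul_smul, inv_mul_cancel₀ hd, one_smul] at h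
  obtain ⟨S', hS', φ, p', h'⟩ := h
  exact ⟨S', hS', φ, p', h'⟩

end Summit.HodgeConjecture.HodgeConjecture.Theorems.NikulinTwinTransport

end
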